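import Literature.AnabelianGeometry.EtaleTheta.Discharge.Sec3Example39CuspidallyPureVerdicts
import Literature.AnabelianGeometry.EtaleTheta.Discharge.Sec5Prop51Example39NonDilating
import Literature.AnabelianGeometry.EtaleTheta.Discharge.Sec5Prop51Thm44Pin
import Literature.AnabelianGeometry.EtaleTheta.Discharge.Sec5Prop51NodeReclosed
import Literature.AlgebraicGeometry.Frobenioids.ArchimedeanPointBaseThm36
import Literature.AlgebraicGeometry.Frobenioids.PadicFrobenioidQpSplit
import HarnessLib

/-!
# [EtTh] Prop. 5.1 (cone node `EtTh:Prop5.1`) RE-CLOSED at the toy Example 3.9 (iv) datum: the closers of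
# `Discharge/Sec5Prop51Example39*.lean` with the FACT binders F-0615 (`Example39_iv_cuspidallyPure`) and F-2363
# (`IsIntegral`) supplied by CLOSED PRODUCERS (K4 / C-R33 re-close evidence, proof-only)

S. Mochizuki, *The étale theta function and its Frobenioid-theoretic manifestations*, Publ. RIMS **45** (2009)
[MochizukiEtTh2009], Prop. 5.1 p. 323 (PDF p. 97): "The Frobenioid `C` is a tempered Frobenioid of rationally standard type
over a slim base category `D`, whose monoid type is `ℤ`, and whose divisor monoid `Φ(−)` is perfect, perf-factorial,
non-dilating, and cuspidally pure. In particular, `C` and the self-equivalence `Ψ` satisfy all of the hypotheses of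
Corollary 3.8, (i), (ii), (iii); Theorem 4.4" [cite: MochizukiEtTh2009, Prop 5.1 p.323 (PDF p.97)]; Example 3.9 (iv) p. 85
(printed 311) [cite: MochizukiEtTh2009, Ex 3.9 p.85]; Def. 3.6 (v) p. 78 [cite: MochizukiEtTh2009, Def 3.6 p.78];
[FrdI] §0 p. 11 ("integral": `M → M^gp` injective) [cite: MochizukiFrdI2008, §0 p.11].

abc-iut cell, layer L2, seat abc-iut-w6-d079 (gen 6); abc-iut-L2-lead (gen 6) K4 RE-CLOSE row «M6» = abc-iut-c312-2's
`CONE-K4-RECLOSE.tsv` v4 row 42 (`EtTh:Prop5.1`, class RECLOSABLE): the node's closers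
`Example39Data.applicability_of_example39` (abc-iut-L2-t9, p411450) / `…_treeMonoidVocab` (abc-iut-w6-d062) /
`…_allPins` (abc-iut-L2-t9) bind two FACT-LIST rows whose universal closures are REFUTED as typed — F-0615
`Example39Data.Example39_iv_cuspidallyPure` (binder `hcp`) and F-2363 `Frobenioids.IsIntegral` (the implicit binder
`hΦ` feeding `TemperedFrobenioid.thetaStub`).  PROOF-ONLY file (0 definitions): both binders are DISCHARGED at the one
datum of the tree where closed producers exist, abc-iut-w5-d164's named toy datum `Toy.example39Data`, `α := 𝟙`,
`h := Toy.frobenioidHyp_example39Data R S` (`ThetaFrobenioidToyGenuine.lean`, p429770; one-object base, `Φ₀ = ℕ`,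
`Φ_α^ell = im(ℕ^pf → ℕ^rlf) ≅ ℚ_{≥0}`, `Φ^{bs-fld} = Φ`, all functions constant), i.e. for
`C₀ := Toy.thetaFrobenioidGenuine R S = Toy.example39Data.thetaFrobenioid (𝟙 _) _`:

* F-2363 is abc-iut-f-128's GENERIC producer `Example39Data.isIntegral_Φ_thetaFrobenioid` (`Sec5Prop51NodeReclosed.lean`, p480266:
  `Φ_α^ell(X)` is a submonoid of a realification, integral over `treeMonoidVocab`), consumed BY NAME at the datum;
* F-0615 is abc-iut-f-144's `Toy.example39_iv_cuspidallyPure_toy` (`Sec3Example39CuspidallyPureVerdicts.lean`), consumed BY NAME;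
* **`Toy.prop51_reclosed_treeMonoidVocab`** — abc-iut-w6-d062's `applicability_of_example39_treeMonoidVocab` AT THE DATUM with
  `hcp`, `hΦ`, `hW` (`isSlim_discretePUnit`, abc-iut-L1) and `hZ` (`rfl`) discharged: for every §5 datum `𝔉` over `C₀`
  (`h𝔉`), every vocabulary-parameter record `P` with its three printed pins, and every self-equivalence `Ψ`,
  `ApplicabilityOfGeneralTheory 𝔉 (thetaVocab 𝔉 P) Ψ` — NO FACT-LIST binder left;
* **`Toy.prop51_reclosed_pinned`** / **`Toy.prop51_reclosed_allPins`** — abc-iut-L2-t9's `applicability_of_example39_pinned` /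
  `applicability_of_example39_allPins` AT THE DATUM with `hcp`, `hΦ`, `hBmon` (`Toy.isMonoidOn_Dα`), `hW`, `hWf`
  (`PadicFrd.isOfFSMType_discretePUnit`), `hZ` and `hKfix` (`D_α` is thin: `Toy.pullGp_iso_hom_eq`) discharged — remaining
  inputs: `hrat` ([FrdI] Def. 4.5 (ii) rationality of the birationalisation data, a vocabulary-level predicate), the §5 datum
  `𝔉`/`h𝔉`, `Ψ`, and (for `allPins`) abc-iut-L1's named [FrdI] Thm. 3.4 (ii) fact `FrdI.Thm34ii` (F-0711, class
  conditional — not a K4 row).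

HONEST FRAMING: a re-close at a DEGENERATE model datum (one object, one prime, `Λ = ℤ`, `α = 𝟙`) — bookkeeping about the
cell's OWN typing (C-R33: the node no longer rests on an assumption label whose ∀-closure is refuted); the printed
Example 3.9 (iv) / Prop. 5.1 for the theta Frobenioid of a curve is neither proved nor refuted here; at genuine-base data
(`Example39Data.ofInducedSquare` over `B^temp(Π_W)⁰`) cuspidal purity is an INPUT on the realified datum and has no
producer in the tree («toy datum only; genuine-datum cuspidally-pure producer = abc-iut-L2-lead VNEXT-CENSUS-L2 add. 9 item»;
abc-iut-L2-lead gen 6 R861: INHABITED-AT-TOY evidence for K4 row 42, complementary to abc-iut-f-128's generic re-key of the node,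
«M6» proper).  Nothing here bears on [IUTchIII] Cor. 3.12; no side taken; typed ≠ proved.
-/

noncomputable section

namespace Literature.AnabelianGeometry.EtaleTheta

open CategoryTheory Opposite Literature.AlgebraicGeometry.Frobenioids FrobenioidTheta TemperedFrobenioid

namespace Toy

variable (R S : ((Example39Data.Dα (𝟙 basePt))ᵒᵖ ⥤ CommMonCat.{0}) → Prop)

/-! ## 1. The small pins at the datum: `D_W` slim and of FSM-type, `Λ = ℤ`, automorphisms of `D_α` act trivially -/

/-- The monoid type of the toy realified data is `ℤ` (`ofRlfZ`). [cite: MochizukiEtTh2009, Def 3.6 p.76] -/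
theorem realifiedGenuine_Λ : realifiedGenuine.Λ = MonoidType.Z := rfl

/-- In the thin over-category `D_α = (D_W)_B[𝟙]` of the toy every automorphism is the identity, so pull-back along it
fixes every class `ξ ∈ Φ_α^ell(X)^gp` — the `hKfix` input of abc-iut-L2-t9's pins (G-w5d250-1: constants fixed by
`Aut(X)`), stated in its exact binder shape, is automatic here.
[cite: MochizukiEtTh2009, Ex 3.9 p.85] -/
theorem pullGp_iso_hom_eq (X : Example39Data.Dα (𝟙 basePt)) (f : X ≅ X)
    (b : realifiedGenuine.BΛ.obj ((thetaFrobenioidGenuine R S).baseOp (op X)))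
    (ξ : Algebra.GrothendieckGroup ((thetaFrobenioidGenuine R S).Φ.carrier (op X)))
    (_hb : b ∈ realifiedGenuine.FΛ ((thetaFrobenioidGenuine R S).baseOp (op X)))
    (_hbξ : (b, ξ) ∈ (thetaFrobenioidGenuine R S).ratFn (op X)) :
    pullGp (thetaFrobenioidGenuine R S).divisorMonoid f.hom ξ = ξ := by
  have hf : f.hom = 𝟙 X := (subsingleton_hom_Dα X X).elim _ _
  rw [hf]
  exact pullGp_id (Φ := (thetaFrobenioidGenuine R S).divisorMonoid) X ξ

/-! ## 2. Prop. 5.1's closers RE-CLOSED at the datum -/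

/-- **Node `EtTh:Prop5.1` RE-CLOSED (K4 / C-R33), vocabulary-parameter form**: abc-iut-w6-d062's
`Example39Data.applicability_of_example39_treeMonoidVocab` at `E := Toy.example39Data`, `α := 𝟙`,
`h := Toy.frobenioidHyp_example39Data R S`, with the F-0615 binder `hcp` := abc-iut-f-144's
`Toy.example39_iv_cuspidallyPure_toy`, the F-2363 binder `hΦ` := abc-iut-f-128's `Example39Data.isIntegral_Φ_thetaFrobenioid`, `hW` :=
`isSlim_discretePUnit` and `hZ := rfl` — for every §5 datum `𝔉` whose Frobenioid-level part is that of
`C₀ = Toy.thetaFrobenioidGenuine R S`, every `P` with its three printed pins («rationally standard», «hypotheses of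
Cor. 3.8», «hypotheses of Thm. 4.4» for `Ψ`) and every self-equivalence `Ψ`.  No FACT-LIST binder remains.
[cite: MochizukiEtTh2009, Prop 5.1 p.323 (PDF p.97)] -/
theorem prop51_reclosed_treeMonoidVocab
    (𝔉 : ThetaFrobenioid.{0} (thetaFrobenioidGenuine R S).category (Example39Data.Dα (𝟙 basePt)))
    (P : (thetaFrobenioidGenuine R S).VocabParams)
    {IsBFT : MorphismProperty (thetaFrobenioidGenuine R S).category}
    (h𝔉 : 𝔉.toTemperedFrobenioidStub =
      (thetaFrobenioidGenuine R S).thetaStub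
        (example39Data.isIntegral_Φ_thetaFrobenioid (𝟙 basePt) (frobenioidHyp_example39Data R S)) IsBFT)
    (Ψ : (thetaFrobenioidGenuine R S).category ≌ (thetaFrobenioidGenuine R S).category)
    (hrs : P.IsRationallyStandard) (h38 : P.HypothesesCor38 Ψ) (h44 : P.HypothesesThm44 Ψ) :
    FrobenioidThetaBiKummer.ApplicabilityOfGeneralTheory 𝔉 (TemperedFrobenioid.thetaVocab 𝔉 P) Ψ :=
  example39Data.applicability_of_example39_treeMonoidVocab (𝟙 basePt) (frobenioidHyp_example39Data R S) 𝔉 P h𝔉 Ψ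
    hrs isSlim_discretePUnit realifiedGenuine_Λ (example39_iv_cuspidallyPure_toy R S) h38 h44

/-- The same for EVERY `Ψ` at once, given the three pins for every `Ψ` (abc-iut-w6-d062's `…_treeMonoidVocab_all` at the
datum). [cite: MochizukiEtTh2009, Prop 5.1 p.323 (PDF p.97)] -/
theorem prop51_reclosed_treeMonoidVocab_all
    (P : (thetaFrobenioidGenuine R S).VocabParams) (hrs : P.IsRationallyStandard)
    (h38 : ∀ Ψ, P.HypothesesCor38 Ψ) (h44 : ∀ Ψ, P.HypothesesThm44 Ψ)
    (𝔉 : ThetaFrobenioid.{0} (thetaFrobenioidGenuine R S).category (Example39Data.Dα (𝟙 basePt)))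
    {IsBFT : MorphismProperty (thetaFrobenioidGenuine R S).category}
    (h𝔉 : 𝔉.toTemperedFrobenioidStub =
      (thetaFrobenioidGenuine R S).thetaStub
        (example39Data.isIntegral_Φ_thetaFrobenioid (𝟙 basePt) (frobenioidHyp_example39Data R S)) IsBFT)
    (Ψ : (thetaFrobenioidGenuine R S).category ≌ (thetaFrobenioidGenuine R S).category) :
    FrobenioidThetaBiKummer.ApplicabilityOfGeneralTheory 𝔉 (TemperedFrobenioid.thetaVocab 𝔉 P) Ψ :=
  prop51_reclosed_treeMonoidVocab R S 𝔉 P h𝔉 Ψ hrs (h38 Ψ) (h44 Ψ)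

/-- **Node `EtTh:Prop5.1` RE-CLOSED, pinned form**: abc-iut-L2-t9's `Example39Data.applicability_of_example39_pinned` at
the datum — "rationally standard" at `PreFrobenioid.rsParams` and "hypotheses of Cor. 3.8" DERIVED there, and here in
addition `hcp` (F-0615), `hΦ` (F-2363), `hBmon` (`Toy.isMonoidOn_Dα`), `hW`, `hWf` (`PadicFrd.isOfFSMType_discretePUnit`),
`hZ`, `hKfix` (`Toy.pullGp_iso_hom_eq`) DISCHARGED.  Remaining inputs: the rationality predicate `hrat` ([FrdI] Def. 4.5
(ii)), the free Thm. 4.4 pin `H44 Ψ`, the §5 datum `𝔉`/`h𝔉` and `Ψ`. [cite: MochizukiEtTh2009, Prop 5.1 p.323 (PDF p.97)] -/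
theorem prop51_reclosed_pinned
    (hrat : ∀ X : (thetaFrobenioidGenuine R S).category,
      PreFrobenioidData.IsRational
        (PreFrobenioid.biratData
          ((thetaFrobenioidGenuine R S).isFrobenioid_treeCatVocab_of_isMonoidOn (isMonoidOn_Dα _))
          (PreFrobenioid.hasBiratSquares_of_isFrobenioid
            ((thetaFrobenioidGenuine R S).isFrobenioid_treeCatVocab_of_isMonoidOn (isMonoidOn_Dα _))))
        (S := PreFrobenioidData.ofFunctor (thetaFrobenioidGenuine R S).divisorMonoid
          (thetaFrobenioidGenuine R S).toElem)
        (fun a 𝔭 => PrimarySupp a 𝔭) X)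
    (H44 : ((thetaFrobenioidGenuine R S).category ≌ (thetaFrobenioidGenuine R S).category) → Prop)
    (𝔉 : ThetaFrobenioid.{0} (thetaFrobenioidGenuine R S).category (Example39Data.Dα (𝟙 basePt)))
    {IsBFT : MorphismProperty (thetaFrobenioidGenuine R S).category}
    (h𝔉 : 𝔉.toTemperedFrobenioidStub =
      (thetaFrobenioidGenuine R S).thetaStub
        (example39Data.isIntegral_Φ_thetaFrobenioid (𝟙 basePt) (frobenioidHyp_example39Data R S)) IsBFT)
    (Ψ : (thetaFrobenioidGenuine R S).category ≌ (thetaFrobenioidGenuine R S).category) (h44 : H44 Ψ) :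
    FrobenioidThetaBiKummer.ApplicabilityOfGeneralTheory 𝔉
      (TemperedFrobenioid.thetaVocab 𝔉
        { IsRationallyStandard :=
            (PreFrobenioidData.ofFunctor (thetaFrobenioidGenuine R S).divisorMonoid
                (thetaFrobenioidGenuine R S).toElem).IsOfRationallyStandardType
              (PreFrobenioid.rsParams
                ((thetaFrobenioidGenuine R S).isFrobenioid_treeCatVocab_of_isMonoidOn (isMonoidOn_Dα _))
                fun a 𝔭 => PrimarySupp a 𝔭)
          HypothesesCor38 := fun Ψ' =>
            ∃ hh : Cor38Hyp (thetaFrobenioidGenuine R S) (thetaFrobenioidGenuine R S), hh.Ψ = Ψ'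
          HypothesesThm44 := H44 })
      Ψ :=
  example39Data.applicability_of_example39_pinned (𝟙 basePt) (frobenioidHyp_example39Data R S) (isMonoidOn_Dα _)
    isSlim_discretePUnit PadicFrd.isOfFSMType_discretePUnit realifiedGenuine_Λ (example39_iv_cuspidallyPure_toy R S)
    hrat (pullGp_iso_hom_eq R S) H44 𝔉 h𝔉 Ψ h44

/-- **Node `EtTh:Prop5.1` RE-CLOSED, all-pins form**: abc-iut-L2-t9's `Example39Data.applicability_of_example39_allPins` at the
datum — all three vocabulary pins DERIVED ("hypotheses of Thm. 4.4" := non-dilating ∧ a base equivalence under `Ψ`, from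
abc-iut-L1's named [FrdI] Thm. 3.4 (ii) fact `FrdI.Thm34ii`, F-0711), and here in addition `hcp` (F-0615), `hΦ` (F-2363),
`hBmon`, `hW`, `hWf`, `hZ`, `hKfix` DISCHARGED.  Remaining inputs: `h34` (F-0711), `hrat`, the §5 datum `𝔉`/`h𝔉`, `Ψ`.
[cite: MochizukiEtTh2009, Prop 5.1 p.323 (PDF p.97)] -/
theorem prop51_reclosed_allPins (h34 : FrdI.Thm34ii.{0, 0, 0, 0, 0})
    (hrat : ∀ X : (thetaFrobenioidGenuine R S).category,
      PreFrobenioidData.IsRational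
        (PreFrobenioid.biratData
          ((thetaFrobenioidGenuine R S).isFrobenioid_treeCatVocab_of_isMonoidOn (isMonoidOn_Dα _))
          (PreFrobenioid.hasBiratSquares_of_isFrobenioid
            ((thetaFrobenioidGenuine R S).isFrobenioid_treeCatVocab_of_isMonoidOn (isMonoidOn_Dα _))))
        (S := PreFrobenioidData.ofFunctor (thetaFrobenioidGenuine R S).divisorMonoid
          (thetaFrobenioidGenuine R S).toElem)
        (fun a 𝔭 => PrimarySupp a 𝔭) X)
    (𝔉 : ThetaFrobenioid.{0} (thetaFrobenioidGenuine R S).category (Example39Data.Dα (𝟙 basePt)))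
    {IsBFT : MorphismProperty (thetaFrobenioidGenuine R S).category}
    (h𝔉 : 𝔉.toTemperedFrobenioidStub =
      (thetaFrobenioidGenuine R S).thetaStub
        (example39Data.isIntegral_Φ_thetaFrobenioid (𝟙 basePt) (frobenioidHyp_example39Data R S)) IsBFT)
    (Ψ : (thetaFrobenioidGenuine R S).category ≌ (thetaFrobenioidGenuine R S).category) :
    FrobenioidThetaBiKummer.ApplicabilityOfGeneralTheory 𝔉
      (TemperedFrobenioid.thetaVocab 𝔉
        { IsRationallyStandard :=
            (PreFrobenioidData.ofFunctor (thetaFrobenioidGenuine R S).divisorMonoid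
                (thetaFrobenioidGenuine R S).toElem).IsOfRationallyStandardType
              (PreFrobenioid.rsParams
                ((thetaFrobenioidGenuine R S).isFrobenioid_treeCatVocab_of_isMonoidOn (isMonoidOn_Dα _))
                fun a 𝔭 => PrimarySupp a 𝔭)
          HypothesesCor38 := fun Ψ' =>
            ∃ hh : Cor38Hyp (thetaFrobenioidGenuine R S) (thetaFrobenioidGenuine R S), hh.Ψ = Ψ'
          HypothesesThm44 := fun Ψ' =>
            (∀ (Y : (Example39Data.Dα (𝟙 basePt))ᵒᵖ) (f : Y ⟶ Y), treeMonoidVocab.{0}.IsNonDilating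
                ((thetaFrobenioidGenuine R S).Φ.carrier Y) ((thetaFrobenioidGenuine R S).Φ.pull f)) ∧
              ∃ Ψbs : Example39Data.Dα (𝟙 basePt) ≌ Example39Data.Dα (𝟙 basePt),
                Nonempty ((thetaFrobenioidGenuine R S).baseFunctorOfCategory ⋙ Ψbs.functor ≅
                  Ψ'.functor ⋙ (thetaFrobenioidGenuine R S).baseFunctorOfCategory) })
      Ψ :=
  example39Data.applicability_of_example39_allPins (𝟙 basePt) (frobenioidHyp_example39Data R S) h34 (isMonoidOn_Dα _)
    isSlim_discretePUnit PadicFrd.isOfFSMType_discretePUnit realifiedGenuine_Λ (example39_iv_cuspidallyPure_toy R S)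
    hrat (pullGp_iso_hom_eq R S) 𝔉 h𝔉 Ψ

end Toy

end Literature.AnabelianGeometry.EtaleTheta

end
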